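import Summits.Ventures.PercRepro.RankLevelSetPrimeCover

/-!
# PercRepro — a PRIME relative hyperplane of the `e`-free core is a cover side of EVERY point outside it (p9, gen 25)

`RankLevelSetPrimeCover` (night-1 g3, (K4)) bounds `|G| ≤ |H₁| + r(G)` when SOME point `x` has a cover `(H₁, H₂)` with
`H₁` prime in `G` and `r(G) ≤ r(H₁) + 1`.  The side hypothesis is not needed: if `H` is prime and `r(G) ≤ r(H) + 1`, then
EVERY `x ∈ G ∖ H` has a cover with side `H` — the two sides of any cover of `x` trace a decomposition `H = (F₁ ∩ H) ∪ (F₂ ∩ H)`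
into `G`-closed sets, primality puts `H` inside one side, and that side is `H` by the rank bound (the `key` step of (K4)).
Hence `G ∖ H` is independent for every prime `H` of corank one, and `|G| ≤ |H| + r(G)`.

* **`exists_cover_side_of_gprime`** — the side lemma;
* **`indep_sdiff_of_gprime`** — `G ∖ H` is independent;
* **`ncard_le_of_gprime`** — `|G| ≤ |H| + r` for every prime `G`-closed `H` with `r(G) ≤ r(H) + 1 ≤ r + 1`;
* **`not_gprime_of_lt_ncard`** — contrapositive: when `|H| + r(G) < |G|`, no `G`-closed `H` of corank one is prime
  (every relative hyperplane of a `16`-point rank-`5` set of the core is a union of two proper closed subsets).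
Axioms: standard.
-/

open scoped Matroid

namespace PercRepro

namespace ThmN

open Set

variable {α : Type}

/-- **The side lemma**: a prime `G`-closed `H` with `r(G) ≤ r(H) + 1` is a side of a cover of every `x ∈ G ∖ H`. -/
theorem exists_cover_side_of_gprime (M : Matroid α) [M.Finite]
    (hfree : ∀ e ∈ M.E, ∃ A ⊆ M.E \ {e}, e ∉ M.closure A ∧ e ∉ M.closure ((M.E \ {e}) \ A))
    {G H : Set α} (hG : G ⊆ M.E) (hH : GClosed M G H) (hprime : GPrime M G H)
    (hrk : M.eRk G ≤ M.eRk H + 1) {x : α} (hx : x ∈ G) (hxH : x ∉ H) :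
    ∃ H₂ : Set α, GClosed M G H₂ ∧ x ∉ H₂ ∧ G \ {x} ⊆ H ∪ H₂ := by
  obtain ⟨F₁, F₂, hF₁, hF₂, hx₁, hx₂, hcov⟩ := exists_cover_of_free M hfree hG hx
  have hHcov : H ⊆ (F₁ ∩ H) ∪ (F₂ ∩ H) := by
    intro z hz
    have hzG : z ∈ G \ {x} := ⟨hH.1 hz, fun h => hxH (h ▸ hz)⟩
    rcases hcov hzG with h | h
    · exact Or.inl ⟨h, hz⟩
    · exact Or.inr ⟨h, hz⟩
  -- a `G`-closed set avoiding `x` and containing `H` is `H` itself (rank bound)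
  have key : ∀ F : Set α, GClosed M G F → x ∉ F → H ⊆ F → F = H := by
    intro F hF hxF hsub
    have hlt := eRk_lt_of_gclosed_ssubset M hG hF hx hxF
    have hle : M.eRk F ≤ M.eRk H := Order.le_of_lt_add_one (lt_of_lt_of_le hlt hrk)
    have hFfin : F.Finite := M.ground_finite.subset (hF.1.trans hG)
    have hsub' : F ⊆ M.closure H := subset_closure_of_eRk_le M hsub (hF.1.trans hG) hFfin hle
    exact Set.Subset.antisymm (fun z hz => hH.2 ⟨hsub' hz, hF.1 hz⟩) hsub
  rcases hprime (F₁ ∩ H) (F₂ ∩ H) (hF₁.inter hH) (hF₂.inter hH) Set.inter_subset_right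
      Set.inter_subset_right hHcov with h | h
  · have hF₁H : F₁ = H := key F₁ hF₁ hx₁ (fun z hz => by
      have hz' : z ∈ F₁ ∩ H := by rw [h]; exact hz
      exact hz'.1)
    exact ⟨F₂, hF₂, hx₂, by rw [← hF₁H]; exact hcov⟩
  · have hF₂H : F₂ = H := key F₂ hF₂ hx₂ (fun z hz => by
      have hz' : z ∈ F₂ ∩ H := by rw [h]; exact hz
      exact hz'.1)
    refine ⟨F₁, hF₁, hx₁, ?_⟩
    intro z hz
    rcases hcov hz with h' | h'
    · exact Or.inr h'
    · exact Or.inl (hF₂H ▸ h')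

/-- **`G ∖ H` is independent** for every prime `G`-closed `H` with `r(G) ≤ r(H) + 1` (no side hypothesis). -/
theorem indep_sdiff_of_gprime (M : Matroid α) [M.Finite]
    (hfree : ∀ e ∈ M.E, ∃ A ⊆ M.E \ {e}, e ∉ M.closure A ∧ e ∉ M.closure ((M.E \ {e}) \ A))
    {G H : Set α} (hG : G ⊆ M.E) (hH : GClosed M G H) (hprime : GPrime M G H)
    (hrk : M.eRk G ≤ M.eRk H + 1) : M.Indep (G \ H) := by
  rcases (G \ H).eq_empty_or_nonempty with hemp | ⟨x, hxG, hxH⟩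
  · rw [hemp]; exact M.empty_indep
  · obtain ⟨H₂, hH₂, hxH₂, hcov⟩ := exists_cover_side_of_gprime M hfree hG hH hprime hrk hxG hxH
    have hind := indep_insert_of_prime_cover M hfree hG hxG hH hH₂ hxH hxH₂ hcov hprime hrk
    have heq : insert x ((G \ {x}) \ H) = G \ H := by
      ext z
      constructor
      · rintro (rfl | hz)
        · exact ⟨hxG, hxH⟩
        · exact ⟨hz.1.1, hz.2⟩
      · intro hz
        by_cases hzx : z = x
        · exact Or.inl hzx
        · exact Or.inr ⟨⟨hz.1, hzx⟩, hz.2⟩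
    rw [heq] at hind
    exact hind

/-- **`|G| ≤ |H| + r`** for every prime `G`-closed `H` with `r(G) ≤ r(H) + 1` and `r(G) ≤ r`. -/
theorem ncard_le_of_gprime (M : Matroid α) [M.Finite]
    (hfree : ∀ e ∈ M.E, ∃ A ⊆ M.E \ {e}, e ∉ M.closure A ∧ e ∉ M.closure ((M.E \ {e}) \ A))
    {G H : Set α} (hG : G ⊆ M.E) (hH : GClosed M G H) (hprime : GPrime M G H)
    (hrk : M.eRk G ≤ M.eRk H + 1) {r : ℕ} (hr : M.eRk G ≤ r) : G.ncard ≤ H.ncard + r := by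
  have hind := indep_sdiff_of_gprime M hfree hG hH hprime hrk
  have hGfin : G.Finite := M.ground_finite.subset hG
  have hsplit : G.ncard = H.ncard + (G \ H).ncard := by
    rw [← Set.ncard_inter_add_ncard_sdiff_eq_ncard G H hGfin, Set.inter_eq_right.mpr hH.1]
  have hle : (G \ H).ncard ≤ r := by
    have h1 : M.eRk (G \ H) ≤ M.eRk G := M.eRk_mono Set.sdiff_subset
    have h2 : M.eRk (G \ H) = ((G \ H).ncard : ℕ∞) := by
      rw [hind.eRk_eq_encard, Set.Finite.cast_ncard_eq (hGfin.subset Set.sdiff_subset)]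
    have h3 : ((G \ H).ncard : ℕ∞) ≤ (r : ℕ∞) := h2 ▸ h1.trans hr
    exact_mod_cast h3
  omega

/-- **No prime relative hyperplane** in a set `G` with `|H| + r(G) < |G|` for every candidate `H`: the contrapositive,
stated for the census use (`16` points, rank `5`, `|H| ≤ 10`). -/
theorem not_gprime_of_lt_ncard (M : Matroid α) [M.Finite]
    (hfree : ∀ e ∈ M.E, ∃ A ⊆ M.E \ {e}, e ∉ M.closure A ∧ e ∉ M.closure ((M.E \ {e}) \ A))
    {G H : Set α} (hG : G ⊆ M.E) (hH : GClosed M G H) (hrk : M.eRk G ≤ M.eRk H + 1) {r : ℕ}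
    (hr : M.eRk G ≤ r) (hlt : H.ncard + r < G.ncard) : ¬ GPrime M G H :=
  fun hprime => absurd (ncard_le_of_gprime M hfree hG hH hprime hrk hr) (not_le.mpr hlt)

end ThmN

end PercRepro
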